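import Summits.ResolutionOfSingularities.ResolutionOfSingularities.Theses.RuledResidues
import Literature.AlgebraicGeometry.Resolution.AffineDomainDimension
import Literature.AlgebraicGeometry.Resolution.ResolutionOfCurves

/-!
# `NonRuledCofinite` (crux `stmt-ResolutionOfSingularities-18076`): the singular-centre clause is
# load-bearing — and the function-field-of-a-curve test kit

Negative lemma for the crux `NonRuledCofinite` of route `ResolutionOfSingularities/RuledResidues`
(cdisprove seat, `--supports stmt-ResolutionOfSingularities-18076`; work file
`Cruxes/NonRuledCofinite/Disproof.lean`).  The crux: for an affine model `R ⊆ K` of `K/k` with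
`Scheme.HasResolution (Spec R)`, the valuation rings `W` of `K` with (1) `k ⊆ W`, (2) `W` a DVR,
(3) `W` a localisation of a finitely generated `k`-algebra, (4) `R ⊆ W` with `R_{𝔪_W ∩ R}` NOT
regular, (5) `W` dominating no regular local ring of dimension `≥ 2` of an affine model, are
finitely many.  The crux is TRUE (they are the codimension-one points of the resolution off its
isomorphism locus); this file shows that the non-regularity clause of (4) cannot be dropped:

* `nonRuledCofinite_false_without_singularCentre` — with "`R_{𝔪_W ∩ R}` not regular" deleted
  (keeping `R ⊆ W`, everything else verbatim) the statement is FALSE at `R = k[X] ⊆ k(X)`,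
  `k = 𝔽₂^alg`: `Spec k[X]` is a curve, so it has a resolution (`hasResolution_of_dim_le_one`),
  conjunct (5) is automatic in transcendence degree one (`not_exists_goodModel`: affine models of
  `k(X)` have dimension `≤ 1`, `ringKrullDim_le_of_fg_of_trdeg_le`), and every place `X - c`
  (`c ∈ k`, pairwise distinct valuation rings) passes (1)(2)(3) and contains `R`.

The kit (`polyModel`, `place v = k[X]_v` as `valuationSubringAtPrime`, `hasResolution_spec`,
`not_exists_goodModel`) is reused by `CuspExceptionalSet.lean` (the cusp `k[t², t³]`).

References: Zariski–Samuel, *Commutative Algebra* II, Ch. VI §14 (prime divisors); Matsumura,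
*Commutative Ring Theory*, Thm. 5.6 (`dim = trdeg`), Thm. 11.2 (localisations of Dedekind domains
are DVRs).
-/

noncomputable section

set_option linter.dupNamespace false

open Polynomial IsDedekindDomain AlgebraicGeometry
open Literature.AlgebraicGeometry.Resolution

namespace Summit.ResolutionOfSingularities.ResolutionOfSingularities.Theorems.NonRuledCofinite.Negative


variable (k : Type) [Field k]

/-- `trdeg_k k(X) = 1`. [folklore] -/
theorem trdeg_ratFunc : Algebra.trdeg k (RatFunc k) = 1 := by
  haveI : Algebra.IsAlgebraic k[X] (RatFunc k) :=
    IsLocalization.isAlgebraic (RatFunc k) (nonZeroDivisors k[X])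
  have h := trdeg_add_eq k k[X] (A := RatFunc k)
  rw [trdeg_eq_zero (R := k[X]) (A := RatFunc k), add_zero, Polynomial.trdeg_of_isDomain] at h
  exact h.symm

/-- Affine models of `k(X)` have Krull dimension `≤ 1`. [folklore] -/
theorem ringKrullDim_le_one (A : Subalgebra k (RatFunc k)) (hA : A.FG)
    [IsFractionRing A (RatFunc k)] : ringKrullDim A ≤ 1 :=
  ringKrullDim_le_of_fg_of_trdeg_le A hA (d := 1) (by rw [trdeg_ratFunc]; exact_mod_cast le_rfl)

/-- No local ring of an affine model of `k(X)` has dimension `≥ 2`. [folklore] -/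
theorem not_two_le_ringKrullDim_localization (A : Subalgebra k (RatFunc k)) (hA : A.FG)
    [IsFractionRing A (RatFunc k)] (q : Ideal A) [q.IsPrime] :
    ¬ (2 : WithBot ℕ∞) ≤ ringKrullDim (Localization.AtPrime q) := by
  intro h2
  have h := IsLocalization.AtPrime.ringKrullDim_eq_height q (Localization.AtPrime q)
  have hq : (q.height : WithBot ℕ∞) ≤ ringKrullDim A := Ideal.height_le_ringKrullDim_of_isPrime
  have h1 := ringKrullDim_le_one k A hA
  have : (2 : WithBot ℕ∞) ≤ 1 := h2.trans (h ▸ hq.trans h1)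
  exact absurd this (by decide)

/-- Affine curves have resolutions: `Spec A` for an affine model `A` of `k(X)`. [folklore] -/
theorem hasResolution_spec (A : Subalgebra k (RatFunc k)) (hA : A.FG)
    [IsFractionRing A (RatFunc k)] : Scheme.HasResolution (Spec (CommRingCat.of A)) := by
  haveI : Algebra.FiniteType k A := A.fg_iff_finiteType.mp hA
  let f : Spec (.of A) ⟶ Spec (.of k) := Spec.map (CommRingCat.ofHom (algebraMap k A))
  haveI : LocallyOfFiniteType f :=
    (HasRingHomProperty.Spec_iff (P := @LocallyOfFiniteType)).mpr
      (RingHom.finiteType_algebraMap.mpr ‹_›)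
  have hdim : topologicalKrullDim (Spec (.of A)) ≤ 1 :=
    (le_of_eq (PrimeSpectrum.topologicalKrullDim_eq_ringKrullDim (R := A))).trans
      (ringKrullDim_le_one k A hA)
  exact hasResolution_of_dim_le_one (Spec (.of A)) f hdim

/-- The polynomial ring as a `k`-subalgebra of `k(X)`. [folklore] -/
def polyModel : Subalgebra k (RatFunc k) := (IsScalarTower.toAlgHom k k[X] (RatFunc k)).range

/-- Membership in the polynomial model: images of polynomials. [folklore] -/
theorem mem_polyModel_iff {x : RatFunc k} :
    x ∈ polyModel k ↔ ∃ p : k[X], algebraMap k[X] (RatFunc k) p = x := by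
  simp [polyModel, AlgHom.mem_range]

/-- Polynomials lie in the polynomial model. [folklore] -/
theorem algebraMap_mem_polyModel (p : k[X]) : algebraMap k[X] (RatFunc k) p ∈ polyModel k :=
  (mem_polyModel_iff k).mpr ⟨p, rfl⟩

/-- `k[X]` is a finitely generated `k`-algebra. [folklore] -/
theorem polyModel_fg : (polyModel k).FG := by
  have h : (⊤ : Subalgebra k k[X]).FG := Algebra.FiniteType.out
  have := h.map (IsScalarTower.toAlgHom k k[X] (RatFunc k))
  rwa [Algebra.map_top] at this


/-- `Frac k[X] = k(X)` for the polynomial model inside `k(X)`. [folklore] -/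
instance isFractionRing_polyModel : IsFractionRing (polyModel k) (RatFunc k) := by
  refine IsFractionRing.of_field (polyModel k) (RatFunc k) fun z => ?_
  refine ⟨⟨_, algebraMap_mem_polyModel k z.num⟩, ⟨_, algebraMap_mem_polyModel k z.denom⟩, ?_⟩
  exact (RatFunc.num_div_denom z).symm


/-! ## Places of `k(X)` -/

variable {k}

/-- The place of `k(X)` at a non-zero prime `v` of `k[X]`: the localisation `k[X]_v` as a
valuation subring of `k(X)` (Mathlib's `valuationSubringAtPrime`). [folklore] -/
abbrev place (v : HeightOneSpectrum k[X]) : ValuationSubring (RatFunc k) :=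
  v.valuationSubringAtPrime (RatFunc k)

/-- `k[X] ⊆ k[X]_v`. [folklore] -/
theorem algebraMap_mem_place (v : HeightOneSpectrum k[X]) (p : k[X]) :
    algebraMap k[X] (RatFunc k) p ∈ place v :=
  Subalgebra.algebraMap_mem
    (Localization.subalgebra.ofField (RatFunc k) _ v.asIdeal.primeCompl_le_nonZeroDivisors) p

/-- The polynomial model lies in every place. [folklore] -/
theorem polyModel_le_place (v : HeightOneSpectrum k[X]) :
    (polyModel k).toSubring ≤ (place v).toSubring := by
  rintro x hx
  obtain ⟨p, rfl⟩ := (mem_polyModel_iff k).mp hx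
  exact algebraMap_mem_place v p

/-- Constants lie in every place (crux conjunct (1)). [folklore] -/
theorem algebraMap_base_mem_place (v : HeightOneSpectrum k[X]) (c : k) :
    algebraMap k (RatFunc k) c ∈ place v := by
  rw [IsScalarTower.algebraMap_apply k k[X] (RatFunc k) c]
  exact algebraMap_mem_place v _

/-- A place of `k(X)` is a DVR (crux conjunct (2); Matsumura Thm. 11.2). [folklore] -/
instance isDiscreteValuationRing_place (v : HeightOneSpectrum k[X]) :
    IsDiscreteValuationRing (place v) :=
  IsLocalization.AtPrime.isDiscreteValuationRing_of_dedekind_domain k[X] v.ne_bot (place v)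

/-- Membership in the place `v` is `v`-integrality. [folklore] -/
theorem mem_place_iff_valuation_le_one (v : HeightOneSpectrum k[X]) (x : RatFunc k) :
    x ∈ place v ↔ v.valuation (RatFunc k) x ≤ 1 := by
  rw [place, HeightOneSpectrum.valuationSubringAtPrime_eq_valuationSubring,
    Valuation.mem_valuationSubring_iff]

/-- The image of `p ∉ v` is a unit of the place, hence not in its non-units. [folklore] -/
theorem algebraMap_not_mem_nonunits (v : HeightOneSpectrum k[X]) {p : k[X]}
    (hp : p ∈ v.asIdeal.primeCompl) : algebraMap k[X] (RatFunc k) p ∉ (place v).nonunits := by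
  intro hmem
  have hu : IsUnit (algebraMap k[X] (place v) p) := IsLocalization.map_units (place v) ⟨p, hp⟩
  have hmax := (ValuationSubring.coe_mem_nonunits_iff (A := place v)).mp
    (show ((algebraMap k[X] (place v) p : place v) : RatFunc k) ∈ (place v).nonunits from hmem)
  exact (IsLocalRing.mem_maximalIdeal _).mp hmax hu

/-- Divisorial shape (crux conjunct 3) of a place: it is the localisation of `k[X]`. [folklore] -/
theorem place_essFiniteType (v : HeightOneSpectrum k[X]) :
    ∃ B : Subalgebra k (RatFunc k), B.FG ∧ B.toSubring ≤ (place v).toSubring ∧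
      ∀ x : RatFunc k, x ∈ place v → ∃ b s : RatFunc k, b ∈ B ∧ s ∈ B ∧
        s ∉ (place v).nonunits ∧ x * s = b := by
  refine ⟨polyModel k, polyModel_fg k, polyModel_le_place v, fun x hx => ?_⟩
  obtain ⟨n, d, hnd⟩ := HeightOneSpectrum.exists_primeCompl_mul_eq_of_integer v x
    ((mem_place_iff_valuation_le_one v x).mp hx)
  exact ⟨_, _, algebraMap_mem_polyModel k n, algebraMap_mem_polyModel k d,
    algebraMap_not_mem_nonunits v d.2, hnd⟩

/-- The place at the linear polynomial `X - c`. [folklore] -/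
def linPlace (c : k) : HeightOneSpectrum k[X] where
  asIdeal := Ideal.span {X - C c}
  isPrime := (Ideal.span_singleton_prime (X_sub_C_ne_zero c)).mpr (prime_X_sub_C c)
  ne_bot := by simp [X_sub_C_ne_zero]

/-- Distinct constants give distinct places: `(X - c₁)⁻¹ ∈ k[X]_{(X - c₂)} ∖ k[X]_{(X - c₁)}`. [folklore] -/
theorem place_linPlace_injective : Function.Injective fun c : k => place (linPlace c) := by
  intro c₁ c₂ h
  by_contra hne
  simp only at h
  set t : RatFunc k := algebraMap k[X] (RatFunc k) (X - C c₁) with ht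
  have ht0 : t ≠ 0 := by
    rw [ht, Ne, FaithfulSMul.algebraMap_eq_zero_iff]
    exact X_sub_C_ne_zero c₁
  -- `t⁻¹ ∈ place c₂`: `X - C c₁ ∉ (X - C c₂)`, so `t` is a `v₂`-unit
  have hmem₂ : t⁻¹ ∈ place (linPlace c₂) := by
    have hp : X - C c₁ ∈ (linPlace c₂).asIdeal.primeCompl := by
      intro hdvd
      change X - C c₁ ∈ Ideal.span {X - C c₂} at hdvd
      rw [Ideal.mem_span_singleton, Polynomial.dvd_iff_isRoot] at hdvd
      simp [sub_eq_zero] at hdvd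
      exact hne hdvd.symm
    rw [mem_place_iff_valuation_le_one, map_inv₀, ht, HeightOneSpectrum.valuation_of_algebraMap,
      ((linPlace c₂).intValuation_eq_one_iff_mem_primeCompl _).mpr hp, inv_one]
  -- `t⁻¹ ∉ place c₁`: `v₁ t < 1`
  have hnmem₁ : t⁻¹ ∉ place (linPlace c₁) := by
    rw [mem_place_iff_valuation_le_one, map_inv₀, inv_le_one₀, not_le, ht]
    · exact (HeightOneSpectrum.valuation_lt_one_iff_mem _ _).mpr (Ideal.mem_span_singleton_self _)
    · exact (Valuation.pos_iff _).mpr ht0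
  exact hnmem₁ (h ▸ hmem₂)

/-- Conjunct (5) of the crux is AUTOMATIC in `k(X)`: no affine model of a function field of
transcendence degree one has a local ring of dimension `≥ 2`. [folklore] -/
theorem not_exists_goodModel (W : ValuationSubring (RatFunc k)) :
    ¬ ∃ A : Subalgebra k (RatFunc k), A.FG ∧ IsFractionRing A (RatFunc k) ∧
      ∃ h : A.toSubring ≤ W.toSubring,
        IsRegularLocalRing (Localization.AtPrime
          (Ideal.comap (Subring.inclusion h) (IsLocalRing.maximalIdeal W))) ∧
        (2 : WithBot ℕ∞) ≤ ringKrullDim (Localization.AtPrime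
          (Ideal.comap (Subring.inclusion h) (IsLocalRing.maximalIdeal W))) := by
  rintro ⟨A, hA, hfr, h, -, hdim⟩
  exact not_two_le_ringKrullDim_localization k A hA _ hdim

/-! ## The singular-centre clause of conjunct (4) is load-bearing -/

variable (k) in
/-- Over an infinite field, the mutated set at `R = k[X] ⊆ k(X)` is infinite: it contains the
pairwise distinct places `X - c`, `c ∈ k`. [folklore] -/
theorem infinite_mutatedSet_polyModel [Infinite k] :
    Set.Infinite {W : ValuationSubring (RatFunc k) | (∀ c : k, algebraMap k (RatFunc k) c ∈ W) ∧
      IsDiscreteValuationRing W ∧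
      (∃ B : Subalgebra k (RatFunc k), B.FG ∧ B.toSubring ≤ W.toSubring ∧ ∀ x : RatFunc k,
        x ∈ W → ∃ b s : RatFunc k, b ∈ B ∧ s ∈ B ∧ s ∉ W.nonunits ∧ x * s = b) ∧
      (polyModel k).toSubring ≤ W.toSubring ∧
      ¬ (∃ A : Subalgebra k (RatFunc k), A.FG ∧ IsFractionRing A (RatFunc k) ∧
        ∃ h : A.toSubring ≤ W.toSubring,
        IsRegularLocalRing (Localization.AtPrime
          (Ideal.comap (Subring.inclusion h) (IsLocalRing.maximalIdeal W))) ∧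
        (2 : WithBot ℕ∞) ≤ ringKrullDim (Localization.AtPrime
          (Ideal.comap (Subring.inclusion h) (IsLocalRing.maximalIdeal W))))} := by
  refine Set.Infinite.mono ?_ (Set.infinite_range_of_injective place_linPlace_injective)
  rintro _ ⟨c, rfl⟩
  exact ⟨algebraMap_base_mem_place _, inferInstance, place_essFiniteType _, polyModel_le_place _,
    not_exists_goodModel _⟩

/-- **Any proof of `NonRuledCofinite` must use the singular-centre clause.**  The statement negated
is the crux `RuledResidues.NonRuledCofinite` with "`¬ IsRegularLocalRing R_{𝔪_W ∩ R}`" deleted from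
conjunct (4) (keeping `R ⊆ W`; conjuncts (1)(2)(3)(5), `R.FG`, `Frac R = K`, `HasResolution`
verbatim).  Witness: `k = 𝔽₂^alg` (any infinite field), `K = k(X)`, `R = k[X]` — a regular curve is
its own resolution and ALL its places pass the mutated predicate. [folklore] -/
theorem nonRuledCofinite_false_without_singularCentre :
    ¬ ∀ (k K : Type) [Field k] [Field K] [Algebra k K] (R : Subalgebra k K), R.FG →
      IsFractionRing R K →
      Literature.AlgebraicGeometry.Resolution.Scheme.HasResolution
        (AlgebraicGeometry.Spec (CommRingCat.of R)) →
      Set.Finite {W : ValuationSubring K | (∀ c : k, algebraMap k K c ∈ W) ∧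
        IsDiscreteValuationRing W ∧
        (∃ B : Subalgebra k K, B.FG ∧ B.toSubring ≤ W.toSubring ∧ ∀ x : K, x ∈ W →
          ∃ b s : K, b ∈ B ∧ s ∈ B ∧ s ∉ W.nonunits ∧ x * s = b) ∧
        R.toSubring ≤ W.toSubring ∧
        ¬ (∃ A : Subalgebra k K, A.FG ∧ IsFractionRing A K ∧ ∃ h : A.toSubring ≤ W.toSubring,
          IsRegularLocalRing (Localization.AtPrime
            (Ideal.comap (Subring.inclusion h) (IsLocalRing.maximalIdeal W))) ∧
          (2 : WithBot ℕ∞) ≤ ringKrullDim (Localization.AtPrime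
            (Ideal.comap (Subring.inclusion h) (IsLocalRing.maximalIdeal W))))} :=
  fun h => infinite_mutatedSet_polyModel (AlgebraicClosure (ZMod 2))
    (h _ (RatFunc (AlgebraicClosure (ZMod 2))) (polyModel _) (polyModel_fg _) inferInstance
      (hasResolution_spec _ _ (polyModel_fg _)))

end Summit.ResolutionOfSingularities.ResolutionOfSingularities.Theorems.NonRuledCofinite.Negative

end
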